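import Literature.Geometry.Manifold.TranslationFlowLocal
import HarnessLib

/-!
# First integrals in a slab, hypotheses along a single integral curve and on a time interval

Family `hodge`, layer `Literature/Geometry/Manifold`; a curve-wise / interval-wise variant of `LiftedFieldFlow`
(`apply_integralCurve_const_of_mfderiv_eq_zero_on_slab`, `apply_integralCurve_lt_of_lt`, `…_gt_of_gt`): there the derivative condition
`df_x(X x) = 0` is required at EVERY point `x` of the slab `a < f x < b`; for the cut-off monodromy fields of a degeneration it only holds on
the part of the slab with prescribed remaining coefficients and small pencil parameter — a set which contains the relevant ORBIT SEGMENT but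
not the whole slab. Here the condition is imposed only along the curve and only for times in an open interval `J`:

* `apply_integralCurve_const_of_slab_on` — if `a < f(γ t₀) < b` and `df(X) = 0` at the points `γ r`, `r ∈ J`, lying in the slab, then
  `f (γ r) = f (γ t₀)` for all `r ∈ J`;
* `apply_integralCurve_lt_of_lt_on`, `apply_integralCurve_gt_of_gt_on` — the curve does not cross a level `s ∈ (a, b)` during `J`.

Everything is proved; no definitions, no named facts.

## References

* [ArnoldGuseinzadeVarchenko2012] V. I. Arnold, S. M. Gusein-Zade, A. N. Varchenko, Singularities of Differentiable Maps II (2012), Part I §1.1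
  (held text p0013, p0025): the monodromy field is tangent to the boundary spheres, so its flow preserves the ball.
* [BrockerJanichIDT1982] T. Bröcker, K. Jänich, Introduction to Differential Topology (1982), (8.12) (proof).
-/

noncomputable section

open Set Function
open scoped Manifold ContDiff Topology

namespace Literature.Geometry.Manifold

universe u

variable {E : Type u} [NormedAddCommGroup E] [NormedSpace ℝ E]
  {H : Type*} [TopologicalSpace H] {I : ModelWithCorners ℝ E H}
  {M : Type*} [TopologicalSpace M] [ChartedSpace H M]
  {f : M → ℝ} {X : Π x : M, TangentSpace I x} {a b : ℝ}

-- the tangent space of `ℝ` is `ℝ` by definition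
set_option backward.isDefEq.respectTransparency false in
/-- **Conservation in a slab, along one curve, during an open time interval.** Let `f` be `C¹`, `γ` an integral curve of `X` on the open
order-connected `J`, and suppose `df_{γ r}(X (γ r)) = 0` whenever `r ∈ J` and `a < f (γ r) < b`. If `t₀ ∈ J` and `a < f (γ t₀) < b` then
`f (γ r) = f (γ t₀)` for all `r ∈ J`. [cite: ArnoldGuseinzadeVarchenko2012, Part I §1.1 (held text p0025)] -/
theorem apply_integralCurve_const_of_slab_on (hf : ContMDiff I 𝓘(ℝ, ℝ) 1 f)
    {γ : ℝ → M} {J : Set ℝ} (hJ : IsOpen J) (hJc : J.OrdConnected) (hγ : IsMIntegralCurveOn γ X J)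
    (hX : ∀ r ∈ J, a < f (γ r) → f (γ r) < b → mfderiv I 𝓘(ℝ, ℝ) f (γ r) (X (γ r)) = 0)
    {t₀ : ℝ} (ht₀ : t₀ ∈ J) (ha : a < f (γ t₀)) (hb : f (γ t₀) < b) {r : ℝ} (hr : r ∈ J) :
    f (γ r) = f (γ t₀) := by
  have hcont : ContinuousOn (f ∘ γ) J := hf.continuous.comp_continuousOn hγ.continuousOn
  -- the lifting region: points of the curve (times in `J`) inside the slab
  set C : Set M := γ '' (J ∩ {r | a < f (γ r) ∧ f (γ r) < b}) with hC
  have hc : ∀ x ∈ C, mfderiv I 𝓘(ℝ, ℝ) f x (X x) = (0 : ℝ) := by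
    rintro _ ⟨r, ⟨hrJ, hra, hrb⟩, rfl⟩
    exact hX r hrJ hra hrb
  -- `S = {r ∈ J | f (γ r) = f (γ t₀)}` is clopen in the (pre)connected `J`
  haveI : PreconnectedSpace J := Subtype.preconnectedSpace hJc.isPreconnected
  let S : Set J := {r | f (γ r) = f (γ t₀)}
  have hSc : IsClosed S := by
    have hc' : Continuous fun r : J => f (γ r) := hcont.comp_continuous continuous_subtype_val (fun r => r.2)
    exact isClosed_eq hc' continuous_const
  have hSo : IsOpen S := by
    rw [isOpen_iff_forall_mem_open]
    intro r₁ hr₁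
    have hr₁J : (r₁ : ℝ) ∈ J := r₁.2
    have hslab : a < f (γ r₁) ∧ f (γ r₁) < b := by
      change f (γ r₁) = f (γ t₀) at hr₁
      exact ⟨by rw [hr₁]; exact ha, by rw [hr₁]; exact hb⟩
    -- an open interval around `r₁` inside `J` on which the curve stays in the slab
    have hO : IsOpen (J ∩ {r | a < f (γ r) ∧ f (γ r) < b}) := hcont.isOpen_inter_preimage hJ isOpen_Ioo
    obtain ⟨ε, hε, hball⟩ := Metric.isOpen_iff.1 hO r₁ ⟨hr₁J, hslab⟩
    rw [Real.ball_eq_Ioo] at hball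
    refine ⟨Subtype.val ⁻¹' Ioo ((r₁ : ℝ) - ε) (r₁ + ε), fun r hr => ?_, isOpen_Ioo.preimage continuous_subtype_val,
      ⟨by change (r₁ : ℝ) - ε < r₁; linarith, by change (r₁ : ℝ) < r₁ + ε; linarith⟩⟩
    have hsubJ : Ioo ((r₁ : ℝ) - ε) (r₁ + ε) ⊆ J := fun r' hr' => (hball hr').1
    have h := apply_integralCurve_eq_add_smul_of_mapsTo (c := (0 : ℝ)) hf hc isOpen_Ioo ordConnected_Ioo
      (hγ.mono hsubJ) (fun r' hr' => ⟨r', hball hr', rfl⟩) (t₀ := (r₁ : ℝ)) ⟨by linarith, by linarith⟩ hr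
    rw [smul_zero, add_zero] at h
    change f (γ r) = f (γ t₀)
    rw [h]
    exact hr₁
  have hSu : S = univ := (isClopen_iff.mp ⟨hSc, hSo⟩).resolve_left
    (Set.nonempty_iff_ne_empty.mp ⟨⟨t₀, ht₀⟩, rfl⟩)
  have : (⟨r, hr⟩ : J) ∈ S := by rw [hSu]; exact mem_univ _
  exact this

/-- **No crossing of a level from below during `J`**: with `a < s < b`, if `f (γ t₀) < s` then `f (γ r) < s` for all `r ∈ J`.
[cite: ArnoldGuseinzadeVarchenko2012, Part I §1.1 (held text p0025)] -/
theorem apply_integralCurve_lt_of_lt_on (hf : ContMDiff I 𝓘(ℝ, ℝ) 1 f)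
    {γ : ℝ → M} {J : Set ℝ} (hJ : IsOpen J) (hJc : J.OrdConnected) (hγ : IsMIntegralCurveOn γ X J)
    (hX : ∀ r ∈ J, a < f (γ r) → f (γ r) < b → mfderiv I 𝓘(ℝ, ℝ) f (γ r) (X (γ r)) = 0)
    {s : ℝ} (has : a < s) (hsb : s < b) {t₀ : ℝ} (ht₀ : t₀ ∈ J) (h0 : f (γ t₀) < s) {t : ℝ} (ht : t ∈ J) :
    f (γ t) < s := by
  by_contra hnot
  have hnot : s ≤ f (γ t) := not_lt.1 hnot
  set c : ℝ := (max a (f (γ t₀)) + s) / 2 with hcdef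
  have hc₁ : a < c := by have := le_max_left a (f (γ t₀)); rw [hcdef]; linarith
  have hc₂ : f (γ t₀) < c := by have := le_max_right a (f (γ t₀)); rw [hcdef]; linarith
  have hc₃ : c < s := by rw [hcdef]; have : max a (f (γ t₀)) < s := max_lt has h0; linarith
  have hseg : uIcc t₀ t ⊆ J := hJc.uIcc_subset ht₀ ht
  have hcont : ContinuousOn (f ∘ γ) (uIcc t₀ t) := (hf.continuous.comp_continuousOn hγ.continuousOn).mono hseg
  obtain ⟨t', ht'seg, ht'⟩ : ∃ t' ∈ uIcc t₀ t, (f ∘ γ) t' = c :=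
    intermediate_value_uIcc hcont (mem_uIcc.2 (Or.inl ⟨hc₂.le, hc₃.le.trans hnot⟩))
  have h := apply_integralCurve_const_of_slab_on hf hJ hJc hγ hX (hseg ht'seg)
    (by rw [show f (γ t') = c from ht']; exact hc₁) (by rw [show f (γ t') = c from ht']; exact hc₃.trans hsb) ht₀
  rw [show f (γ t') = c from ht'] at h
  exact (lt_irrefl c) (h ▸ hc₂)

/-- **No crossing of a level from above during `J`**: with `a < s < b`, if `s < f (γ t₀)` then `s < f (γ r)` for all `r ∈ J`.
[cite: ArnoldGuseinzadeVarchenko2012, Part I §1.1 (held text p0025)] -/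
theorem apply_integralCurve_gt_of_gt_on (hf : ContMDiff I 𝓘(ℝ, ℝ) 1 f)
    {γ : ℝ → M} {J : Set ℝ} (hJ : IsOpen J) (hJc : J.OrdConnected) (hγ : IsMIntegralCurveOn γ X J)
    (hX : ∀ r ∈ J, a < f (γ r) → f (γ r) < b → mfderiv I 𝓘(ℝ, ℝ) f (γ r) (X (γ r)) = 0)
    {s : ℝ} (has : a < s) (hsb : s < b) {t₀ : ℝ} (ht₀ : t₀ ∈ J) (h0 : s < f (γ t₀)) {t : ℝ} (ht : t ∈ J) :
    s < f (γ t) := by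
  by_contra hnot
  have hnot : f (γ t) ≤ s := not_lt.1 hnot
  set c : ℝ := (min b (f (γ t₀)) + s) / 2 with hcdef
  have hc₁ : c < b := by have := min_le_left b (f (γ t₀)); rw [hcdef]; linarith
  have hc₂ : c < f (γ t₀) := by have := min_le_right b (f (γ t₀)); rw [hcdef]; linarith
  have hc₃ : s < c := by rw [hcdef]; have : s < min b (f (γ t₀)) := lt_min hsb h0; linarith
  have hseg : uIcc t₀ t ⊆ J := hJc.uIcc_subset ht₀ ht
  have hcont : ContinuousOn (f ∘ γ) (uIcc t₀ t) := (hf.continuous.comp_continuousOn hγ.continuousOn).mono hseg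
  obtain ⟨t', ht'seg, ht'⟩ : ∃ t' ∈ uIcc t₀ t, (f ∘ γ) t' = c :=
    intermediate_value_uIcc hcont (mem_uIcc.2 (Or.inr ⟨(hnot.trans hc₃.le), hc₂.le⟩))
  have h := apply_integralCurve_const_of_slab_on hf hJ hJc hγ hX (hseg ht'seg)
    (by rw [show f (γ t') = c from ht']; exact has.trans hc₃) (by rw [show f (γ t') = c from ht']; exact hc₁) ht₀
  rw [show f (γ t') = c from ht'] at h
  exact (lt_irrefl c) (h ▸ hc₂)

end Literature.Geometry.Manifold

end
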